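import Mathlib
import Summits.Ventures.HodgeRepro.Tier4.Target
import Summits.Ventures.HodgeRepro.Tier4.Line3.Defs
import Summits.Ventures.HodgeRepro.Tier4.Line3.LocaliserS
import Summits.Ventures.HodgeRepro.Tier4.Line3.KernelBound
import Summits.Ventures.HodgeRepro.Tier4.Line3.ClassBoundGauss
import Summits.Ventures.HodgeRepro.Tier4.Line3.ClassBoundDef
import Summits.Ventures.HodgeRepro.Tier4.Line3.StableLattice
import Summits.Ventures.HodgeRepro.Tier4.Line3.LatticeGaussDefs
import Summits.Ventures.HodgeRepro.Tier4.Line3.LatticeGaussPointwise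
import Summits.Ventures.HodgeRepro.Tier4.Line3.LatticeGaussSum
import Summits.Ventures.HodgeRepro.Tier4.Line3.SuppMajorantBound
import Summits.Ventures.HodgeRepro.Tier4.Line3.InvariantMajorantDef

/-!
# Tier4/Line3/InvMajorantMass — (I4) THE THETA MASS OF THE INVARIANT MAJORANT on a compact of the ball

Blind re-derivation cell `pub-hodge-repro`, Tier 4 «PROVE THE STEP» (README §9–§10), LINE L3, seat t4-x2 (reserve
wall-breaker) on rung (I4) of t4-L2-p3 g2's invariant route for L3.5's residual (S12951 / S12979 (2); claimed S13074).

t4-L2-p3 g2's INVARIANT MAJORANT (InvariantMajorantDef) is `invMajorant D e c₁ w z = gammaInf e c₁ (rep w) · kerMaj D (rep w) z`,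
the `Γ⁴`-orbit infimum of the slot majorants times the kernel with a quarter of its Gaussian given back.  It is dominated
POINTWISE on the ball by the (non-invariant) majorant with the definite Gaussians (`invMajorant_le_majorantDefAt`):
`gammaInf ≤` its value at `g = 1`, `‖kernel‖ ≤ aNorm⁴ ∏ (Σ‖y‖)² e^{−π maj}` (KernelBound) and `e^{−π maj} e^{(π/4) maj} ≤
e^{−(π/2) maj}` (`maj ≥ 0` on the ball).  Hence the mass of the invariant majorant over the off-main line tuples of
`linesOf (denomLattice d)` — the `Γ`-stable set of the line tuples with a representative in `d⁻¹ 𝒪³` (StableLattice) —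
is at most the lattice Gaussian sum of (R2) (`tsum_indicator_linesOf_le` + `exists_vecFactor_tsum_le`):
`Σ_{w ∈ invSet} invMajorant D e c₁ w z ≤ A / (1 − |z|²)^m` on the whole ball (`exists_invMajorant_tsum_le`), so
`≤ A / (1 − r₀)^m` on the compact `{nsq ≤ r₀}` (`exists_invMajorant_tsum_le_of_nsq_le`, the shape of (I4)), and the
`ℝ≥0∞`-density `invMajorantDensity` is `≤ ofReal A′` there (`invMajorantDensity_le_of_nsq_le`).

Nothing here asserts anything about the truth of (P); HC_CM is NOT proved by anyone in this repository.
-/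

set_option autoImplicit false

noncomputable section

namespace Summit.Ventures.HodgeRepro.Tier4.Line3

open Matrix NumberField

namespace T4Data

variable (X : T4Data)

/-- The orbit infimum is at most the value at `g = 1`: `gammaInf e c₁ x ≤ ∏_k slotMaj e c₁ (x k)`. -/
theorem gammaInf_le_one (e c₁ : ℝ) (x : X.Tuple) : X.gammaInf e c₁ x ≤ ∏ k, X.slotMaj e c₁ (x k) := by
  have h := X.gammaInf_le e c₁ x (fun _ => ⟨1, X.hΓ.1⟩)
  unfold quadMaj at h
  simpa only [Matrix.one_mulVec] using h

/-- **THE INVARIANT MAJORANT IS DOMINATED BY THE MAJORANT WITH THE DEFINITE GAUSSIANS** on the ball. -/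
theorem invMajorant_le_majorantDefAt (D : X.ThetaData) (e c₁ : ℝ) (w : X.LineTuple) (z : Fin 2 → ℂ)
    (hz : z ∈ ball) : X.invMajorant D e c₁ w z ≤ X.majorantDefAt c₁ D.Φ e w z := by
  unfold invMajorant kerMaj
  rw [X.majorantDefAt_eq_prod]
  set x : X.Tuple := X.rep w with hx
  set a : ℝ := aNorm D.Φ z 0 + aNorm D.Φ z 1 with ha
  have ha0 : 0 ≤ a := add_nonneg (aNorm_nonneg _ _ _) (aNorm_nonneg _ _ _)
  have h1 := X.gammaInf_le_one e c₁ x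
  have h2 := X.norm_kernel_le D.Φ x z
  -- slot by slot: `slotMaj · (Σ‖y‖)² e^{−π maj} · e^{(π/4) maj} ≤ vecFactor`
  have hk : ∀ k, X.slotMaj e c₁ (x k) *
      ((∑ i, ‖X.ballCoord (x k) i‖) ^ 2 * Real.exp (-Real.pi * maj (X.ballCoord (x k)) z)) *
        Real.exp (Real.pi / 4 * maj (X.ballCoord (x k)) z) ≤ X.vecFactor c₁ e (x k) z := by
    intro k
    unfold slotMaj vecFactor
    have hm : 0 ≤ maj (X.ballCoord (x k)) z := maj_nonneg' _ _ hz
    have hexp : Real.exp (-Real.pi * maj (X.ballCoord (x k)) z) * Real.exp (Real.pi / 4 * maj (X.ballCoord (x k)) z) ≤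
        Real.exp (-(Real.pi / 2) * maj (X.ballCoord (x k)) z) := by
      rw [← Real.exp_add, Real.exp_le_exp]
      nlinarith [Real.pi_pos]
    have hA : 0 ≤ (1 + ‖X.ballCoord (x k)‖) ^ e := Real.rpow_nonneg (by positivity) _
    have hB : 0 ≤ X.gaussDefAt c₁ (x k) := X.gaussDefAt_nonneg _ _
    have hC : 0 ≤ (∑ i, ‖X.ballCoord (x k) i‖) ^ 2 := sq_nonneg _
    calc (1 + ‖X.ballCoord (x k)‖) ^ e * X.gaussDefAt c₁ (x k) *
          ((∑ i, ‖X.ballCoord (x k) i‖) ^ 2 * Real.exp (-Real.pi * maj (X.ballCoord (x k)) z)) *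
            Real.exp (Real.pi / 4 * maj (X.ballCoord (x k)) z)
        = ((1 + ‖X.ballCoord (x k)‖) ^ e * X.gaussDefAt c₁ (x k) * (∑ i, ‖X.ballCoord (x k) i‖) ^ 2) *
            (Real.exp (-Real.pi * maj (X.ballCoord (x k)) z) * Real.exp (Real.pi / 4 * maj (X.ballCoord (x k)) z)) := by
          ring
      _ ≤ ((1 + ‖X.ballCoord (x k)‖) ^ e * X.gaussDefAt c₁ (x k) * (∑ i, ‖X.ballCoord (x k) i‖) ^ 2) *
            Real.exp (-(Real.pi / 2) * maj (X.ballCoord (x k)) z) :=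
          mul_le_mul_of_nonneg_left hexp (by positivity)
      _ = _ := by ring
  have hprodk : ∀ k, 0 ≤ X.slotMaj e c₁ (x k) *
      ((∑ i, ‖X.ballCoord (x k) i‖) ^ 2 * Real.exp (-Real.pi * maj (X.ballCoord (x k)) z)) *
        Real.exp (Real.pi / 4 * maj (X.ballCoord (x k)) z) := fun k =>
    mul_nonneg (mul_nonneg (X.slotMaj_nonneg _ _ _) (mul_nonneg (sq_nonneg _) (Real.exp_pos _).le)) (Real.exp_pos _).le
  have hexp0 : 0 ≤ ∏ k, Real.exp (Real.pi / 4 * maj (X.ballCoord (x k)) z) :=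
    Finset.prod_nonneg fun _ _ => (Real.exp_pos _).le
  have hkb0 : 0 ≤ a ^ 4 * ∏ j, ((∑ i, ‖X.ballCoord (x j) i‖) ^ 2 * Real.exp (-Real.pi * maj (X.ballCoord (x j)) z)) :=
    mul_nonneg (pow_nonneg ha0 _) (Finset.prod_nonneg fun _ _ => mul_nonneg (sq_nonneg _) (Real.exp_pos _).le)
  calc X.gammaInf e c₁ x * (‖X.kernel D.Φ x z‖ * ∏ k, Real.exp (Real.pi / 4 * maj (X.ballCoord (x k)) z))
      ≤ (∏ k, X.slotMaj e c₁ (x k)) *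
          ((a ^ 4 * ∏ j, ((∑ i, ‖X.ballCoord (x j) i‖) ^ 2 * Real.exp (-Real.pi * maj (X.ballCoord (x j)) z))) *
            ∏ k, Real.exp (Real.pi / 4 * maj (X.ballCoord (x k)) z)) :=
        mul_le_mul h1 (mul_le_mul_of_nonneg_right h2 hexp0)
          (mul_nonneg (norm_nonneg _) hexp0) (Finset.prod_nonneg fun _ _ => X.slotMaj_nonneg _ _ _)
    _ = a ^ 4 * ∏ k, (X.slotMaj e c₁ (x k) *
          ((∑ i, ‖X.ballCoord (x k) i‖) ^ 2 * Real.exp (-Real.pi * maj (X.ballCoord (x k)) z)) *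
            Real.exp (Real.pi / 4 * maj (X.ballCoord (x k)) z)) := by
        simp only [Finset.prod_mul_distrib]
        ring
    _ ≤ a ^ 4 * ∏ k, X.vecFactor c₁ e (x k) z :=
        mul_le_mul_of_nonneg_left (Finset.prod_le_prod (fun k _ => hprodk k) fun k _ => hk k) (pow_nonneg ha0 _)

/-- **THE LATTICE GAUSSIAN SUM OVER THE LINES OF `L⁴`, with the `aNorm` factor absorbed**: for a finitely generated
`L`, `Σ_w 1_{linesOf L}(w) · majorantDefAt c₁ Φ e w z ≤ A / (1 − |z|²)^m` on the ball (the per-lattice bound of (R2)). -/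
theorem exists_tsum_indicator_linesOf_le (D : X.ThetaData) (p : IsDedekindDomain.HeightOneSpectrum (RingOfIntegers X.E))
    {L : Submodule (RingOfIntegers X.E) (Fin 3 → X.E)} (hL : L.FG) {c₁ : ℝ} (hc₁ : 0 < c₁) (e : ℝ) :
    ∃ A m : ℝ, 0 ≤ A ∧ 0 ≤ m ∧ ∀ z ∈ ball,
      Summable ((X.linesOf L).indicator fun w => X.majorantDefAt c₁ D.Φ e w z) ∧
        ∑' w, (X.linesOf L).indicator (fun w => X.majorantDefAt c₁ D.Φ e w z) w ≤ A / (1 - nsq z) ^ m := by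
  obtain ⟨A₀, m₀, hA₀, hm₀, htheta⟩ := X.exists_vecFactor_tsum_le p hL hc₁ e
  obtain ⟨CΦ, mΦ, hCm⟩ := D.Φ.growth
  set C₀ : ℝ := max CΦ 0 with hC₀
  have hC₀0 : 0 ≤ C₀ := le_max_right _ _
  have hCm' : ∀ z ∈ ball, ∀ k i j, ‖D.Φ.A z k i j‖ ≤ C₀ / (1 - nsq z) ^ mΦ := by
    intro z hz k i j
    refine (hCm z hz k i j).trans ?_
    have hpos : 0 < (1 - nsq z) ^ mΦ := by
      have : nsq z < 1 := hz
      exact Real.rpow_pos_of_pos (by linarith) _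
    exact div_le_div_of_nonneg_right (le_max_left _ _) hpos.le
  set mΦ' : ℝ := max mΦ 0 with hmΦ'
  have hmΦ'0 : 0 ≤ mΦ' := le_max_right _ _
  refine ⟨(18 * C₀) ^ 4 * A₀ ^ 4, mΦ' * 4 + m₀ * 4, by positivity, by positivity, fun z hz => ?_⟩
  have hz1 : nsq z < 1 := hz
  have ht : 0 < 1 - nsq z := by linarith
  have ht1 : 1 - nsq z ≤ 1 := by
    have : 0 ≤ nsq z := by unfold nsq; positivity
    linarith
  obtain ⟨hsumL, hboundL⟩ := htheta z hz
  obtain ⟨hind, hle⟩ := X.tsum_indicator_linesOf_le c₁ D.Φ e L z hsumL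
  refine ⟨hind, hle.trans ?_⟩
  have ha : aNorm D.Φ z 0 + aNorm D.Φ z 1 ≤ 18 * (C₀ / (1 - nsq z) ^ mΦ') := by
    have h0 := aNorm_le D.Φ z hz 0 hCm'
    have h1 := aNorm_le D.Φ z hz 1 hCm'
    have hm : C₀ / (1 - nsq z) ^ mΦ ≤ C₀ / (1 - nsq z) ^ mΦ' :=
      div_rpow_le_div_rpow ht ht1 hC₀0 (le_max_left _ _)
    linarith
  have hsum0 : 0 ≤ ∑' v : L, X.vecFactor c₁ e v z := tsum_nonneg fun v => X.vecFactor_nonneg _ _ _ _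
  have ha0 : 0 ≤ aNorm D.Φ z 0 + aNorm D.Φ z 1 := add_nonneg (aNorm_nonneg _ _ _) (aNorm_nonneg _ _ _)
  have hd0 : 0 ≤ 18 * (C₀ / (1 - nsq z) ^ mΦ') := by positivity
  calc (aNorm D.Φ z 0 + aNorm D.Φ z 1) ^ 4 * (∑' v : L, X.vecFactor c₁ e v z) ^ 4
      ≤ (18 * (C₀ / (1 - nsq z) ^ mΦ')) ^ 4 * (A₀ / (1 - nsq z) ^ m₀) ^ 4 :=
        mul_le_mul (pow_le_pow_left₀ ha0 ha 4) (pow_le_pow_left₀ hsum0 hboundL 4) (pow_nonneg hsum0 _)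
          (pow_nonneg hd0 _)
    _ = (18 * C₀) ^ 4 * A₀ ^ 4 / (1 - nsq z) ^ (mΦ' * 4 + m₀ * 4) := by
        rw [← mul_div_assoc, div_pow, div_pow, ← Real.rpow_natCast ((1 - nsq z) ^ mΦ') 4,
          ← Real.rpow_natCast ((1 - nsq z) ^ m₀) 4, ← Real.rpow_mul ht.le, ← Real.rpow_mul ht.le,
          Real.rpow_add ht]
        push_cast
        rw [div_mul_div_comm]

/-- **(I4) ON THE WHOLE BALL**: the invariant majorant is summable over the off-main line tuples of `linesOf (denomLattice d)`
at every `z ∈ 𝔹`, with `Σ ≤ A / (1 − |z|²)^m`. -/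
theorem exists_invMajorant_tsum_le (D : X.ThetaData) (p : IsDedekindDomain.HeightOneSpectrum (RingOfIntegers X.E))
    {d : RingOfIntegers X.E} (hd : d ≠ 0) (xm : X.Tuple) (e : ℝ) {c₁ : ℝ} (hc₁ : 0 < c₁) :
    ∃ A m : ℝ, 0 ≤ A ∧ 0 ≤ m ∧ ∀ z ∈ ball,
      Summable (fun w : X.invSet (X.linesOf (X.denomLattice d)) xm => X.invMajorant D e c₁ w.1 z) ∧
        ∑' w : X.invSet (X.linesOf (X.denomLattice d)) xm, X.invMajorant D e c₁ w.1 z ≤ A / (1 - nsq z) ^ m := by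
  obtain ⟨A, m, hA, hm, hbound⟩ :=
    X.exists_tsum_indicator_linesOf_le D p (X.isLattice_denomLattice hd).1 hc₁ e
  refine ⟨A, m, hA, hm, fun z hz => ?_⟩
  obtain ⟨hind, hle⟩ := hbound z hz
  set f : X.LineTuple → ℝ := fun w => X.majorantDefAt c₁ D.Φ e w z with hf
  have hsub : X.invSet (X.linesOf (X.denomLattice d)) xm ⊆ X.linesOf (X.denomLattice d) := fun w hw => hw.1
  have hf0 : ∀ w, 0 ≤ f w := fun w => X.majorantDefAt_nonneg _ _ _ _ _
  -- the indicator of the smaller set is summable and has the smaller sum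
  have hind' : Summable ((X.invSet (X.linesOf (X.denomLattice d)) xm).indicator f) :=
    Summable.of_nonneg_of_le (fun w => Set.indicator_nonneg (fun w _ => hf0 w) w)
      (fun w => Set.indicator_le_indicator_of_subset hsub hf0 w) hind
  have hsubS : Summable fun w : X.invSet (X.linesOf (X.denomLattice d)) xm => f w.1 :=
    summable_subtype_iff_indicator.mpr hind'
  have hle' : ∀ w : X.invSet (X.linesOf (X.denomLattice d)) xm, X.invMajorant D e c₁ w.1 z ≤ f w.1 :=
    fun w => X.invMajorant_le_majorantDefAt D e c₁ w.1 z hz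
  have hsum : Summable fun w : X.invSet (X.linesOf (X.denomLattice d)) xm => X.invMajorant D e c₁ w.1 z :=
    Summable.of_nonneg_of_le (fun w => X.invMajorant_nonneg _ _ _ _ _) hle' hsubS
  refine ⟨hsum, ?_⟩
  calc ∑' w : X.invSet (X.linesOf (X.denomLattice d)) xm, X.invMajorant D e c₁ w.1 z
      ≤ ∑' w : X.invSet (X.linesOf (X.denomLattice d)) xm, f w.1 := Summable.tsum_le_tsum hle' hsum hsubS
    _ = ∑' w, (X.invSet (X.linesOf (X.denomLattice d)) xm).indicator f w := tsum_subtype _ f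
    _ ≤ ∑' w, (X.linesOf (X.denomLattice d)).indicator f w :=
        Summable.tsum_le_tsum (fun w => Set.indicator_le_indicator_of_subset hsub hf0 w) hind' hind
    _ ≤ A / (1 - nsq z) ^ m := hle

/-- **(I4) THE THETA MASS OF THE INVARIANT MAJORANT ON A COMPACT** (t4-L2-p3 g2's shape, S12979 (2)): for every
`r₀ < 1` there is `A` with `Σ_{w ∈ invSet} invMajorant D e c₁ w z ≤ A` for all `z` with `nsq z ≤ r₀`. -/
theorem exists_invMajorant_tsum_le_of_nsq_le (D : X.ThetaData)
    (p : IsDedekindDomain.HeightOneSpectrum (RingOfIntegers X.E)) {d : RingOfIntegers X.E} (hd : d ≠ 0)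
    (xm : X.Tuple) (e : ℝ) {c₁ : ℝ} (hc₁ : 0 < c₁) {r₀ : ℝ} (hr₀ : r₀ < 1) :
    ∃ A : ℝ, 0 ≤ A ∧ ∀ z : Fin 2 → ℂ, nsq z ≤ r₀ →
      Summable (fun w : X.invSet (X.linesOf (X.denomLattice d)) xm => X.invMajorant D e c₁ w.1 z) ∧
        ∑' w : X.invSet (X.linesOf (X.denomLattice d)) xm, X.invMajorant D e c₁ w.1 z ≤ A := by
  obtain ⟨A, m, hA, hm, hbound⟩ := X.exists_invMajorant_tsum_le D p hd xm e hc₁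
  refine ⟨A / (1 - r₀) ^ m, by positivity, fun z hz => ?_⟩
  have hzb : z ∈ ball := by
    show nsq z < 1
    linarith
  obtain ⟨hsum, hle⟩ := hbound z hzb
  refine ⟨hsum, hle.trans ?_⟩
  have ht : 0 < 1 - r₀ := by linarith
  have h1 : 1 - r₀ ≤ 1 - nsq z := by linarith
  have hpos : 0 < (1 - r₀) ^ m := Real.rpow_pos_of_pos ht _
  exact div_le_div_of_nonneg_left hA hpos (Real.rpow_le_rpow ht.le h1 hm)

/-- **(I4) FOR THE DENSITY**: `invMajorantDensity D (linesOf (denomLattice d)) xm e c₁ z ≤ ofReal A` on `{nsq ≤ r₀}`. -/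
theorem exists_invMajorantDensity_le_of_nsq_le (D : X.ThetaData)
    (p : IsDedekindDomain.HeightOneSpectrum (RingOfIntegers X.E)) {d : RingOfIntegers X.E} (hd : d ≠ 0)
    (xm : X.Tuple) (e : ℝ) {c₁ : ℝ} (hc₁ : 0 < c₁) {r₀ : ℝ} (hr₀ : r₀ < 1) :
    ∃ A : ℝ, 0 ≤ A ∧ ∀ z : Fin 2 → ℂ, nsq z ≤ r₀ →
      X.invMajorantDensity D (X.linesOf (X.denomLattice d)) xm e c₁ z ≤ ENNReal.ofReal A := by
  obtain ⟨A, hA, hbound⟩ := X.exists_invMajorant_tsum_le_of_nsq_le D p hd xm e hc₁ hr₀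
  refine ⟨A, hA, fun z hz => ?_⟩
  obtain ⟨hsum, hle⟩ := hbound z hz
  unfold invMajorantDensity
  rw [← ENNReal.ofReal_tsum_of_nonneg (fun w => X.invMajorant_nonneg _ _ _ _ _) hsum]
  exact ENNReal.ofReal_le_ofReal hle

end T4Data

end Summit.Ventures.HodgeRepro.Tier4.Line3

end
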